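import Mathlib
import Summits.NavierStokesRegularity.NavierStokesRegularity.Theorems.TaoLadderRungTwoFlatNearBehindStepHalo
import Summits.NavierStokesRegularity.NavierStokesRegularity.Theorems.TaoLadderRungTwoFlatInterfaceLoop
import HarnessLib

/-!
# The NEAR and BEHIND per-hop obligations of the R54 tube at the choice rule WITH THE INTERFACE LOOP OF RECORD
  (theory-1 g48 numT61 design P-61a: the in-hop core input `hcoreIn` of `…NearBehindStepHalo` replaced by the section datum
  `hsec`, the carrier deviation one shell deeper `hcore2`, and two certified interface levels `hlevC`/`hlevV`)
  (helper for the K_A♭ parent item stmt-NavierStokesRegularity-22987 `FlatGapCertificatesV2`, child 2A `GradedAdiabaticWakeA` of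
  route TaoLadderRungTwoFlat; cell harvest/h2-tao-ladder, p1 g24; LADDER §59–§61)

`HopTube.tubeStepNearBehindR54_of_schedule_halo` (p1 g23, of record) takes the in-hop deviation at the interface shell `1−K`
as a hypothesis `hcoreIn : |(S−W)ᵢ(1−K, s)| ≤ r_c` — referee W-27 / theory-1 TRAP #19: no scalar-feasible producer of that
input exists via gauge-Grönwall loops. theory-1 numT61: the interface is a two-variable bootstrap (`R54.interface_apriori_of_pseudoFlows`)
closed by H(n)'s section datum `r_s` at `1−K`, the near→core pump (near level at `−K`, integral weights `I₁`, `I₂`), and the carrier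
deviation at `2−K` (`ρ₂`, the ONLY exogenous core input left, `O(δ(n)/ω)`, theory-1 L-61d). This module composes:

* `interfaceStart_le_of_clauses` — the section datum `hsec` from H(n)'s core clause at `1−K`, the kick and the reference start;
* `interfaceLevels_of_schedule_iface` — at every good time `t` of every premise of hop `n > N₀` of the R54 tube, the interface
  deviations stay below `(RBAR, BBAR)` on `[0, t]` (this is ALSO the `hlev` input of the core contract
  `HopTube.tubeStepCoreWith_of_landing`, theory-1 numT62, with `lev = (RBAR, BBAR)` at the interface shell);
* `tubeStepNearBehindR54_of_schedule_iface` — `TubeStepNearWith ∧ TubeStepBehindWith` of the R54 tube at the choice rule from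
  the schedule hypotheses of `…_halo` with: `hcoreIn`/`hrc0` REMOVED; ADDED `hK : 1 ≤ K`, `hθV : 0 < θ_V`, `hM₂`, `hsec`, `hcore2`,
  the interface data `(RBAR, BBAR ≤ r, ρ₂, r_s, I₁, I₂, PUMP)` with `hPUMPdef`, `hlevC` (L-61a), `hlevV` (L-61b), the link facts
  `hI₁ : 2(e^{θ_V/2} − 1) ≤ I₁θ_V`, `hI₂ : e^{θ_V} − 1 ≤ I₂θ_V`; CHANGED `hA₀def : A₀ = M + r`, `hrA : r ≤ A`, and the top summand
  of `hENdef` (D16): `1·r·(2V̄_N + ε·r·√(2V̄_N) + (1+ε)·M·r)`.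

CO-SCALED REFERENCE (theory-1 g49 TRAP #25, cure (α), adopted): the reference flow is a FAMILY `W z` indexed by the premise's tube state
`z` (intended: `W_z(t) = x_z·U(x_z·t)`, the exact flow of `x_z·u⋆`, so that the start mismatch at the interface and head-block shells is
identically zero); `hWflow`, `hM`, `hM₁`, `hM₂` hold under `∀ z, InTubeWith … n z →`, and `hEW`, `hsec`, `hcore2`, `hRT` read `W z`. A fixed
reference is the constant family.

LITERAL SHAPES (for theory-1's P-61c dictionary; `c̄ = 1`, `δ = ε`):
`PUMP = 1·c₀·((2+ε)·M·I₁·√(2·V̄N) + 2·I₂·V̄N)`;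
`hlevC : rs + PUMP + 1·c₀·((ε·(M + I₁·√(2·V̄N)) + ε·M + ε·BBAR)·RBAR + (2+ε)·M·BBAR + BBAR^2) < RBAR`;
`hlevV : rs + 1·c₀·((M + M₂ + RBAR + RHO2)·BBAR + (1+2ε)·M·RBAR + ε·RBAR^2 + (M + 2ε·M₂)·RHO2 + ε·RHO2^2) < BBAR`.

HONEST FRAMING: bookkeeping over the cell's typed induction frame and p1's zone lemmas (MODEL lattice, graded mirror table on
`S♭`, `m = 2`); the reference flow, the deeper core input `ρ₂`, the template landing residual `R_T`, the anchor-scale lower bound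
`a_lo` and every scalar schedule inequality are HYPOTHESES; nothing certified; no item closed; nothing about the Navier–Stokes
equations.
-/

noncomputable section

-- the sub-problem namespace repeats the summit name by design (D-0017)
set_option linter.dupNamespace false

namespace Summit.NavierStokesRegularity.NavierStokesRegularity.Theorems.HopTube

open Set Finset Literature.Analysis.FluidPDE Literature.Analysis.FluidPDE.TaoCascade MirrorPulse GappedFrontRobustOn

/-- **The section datum at the interface shell from the clauses of `H(n)`** (the `hsec` input, theory-1 numT61: "not a new
input"): kick (`w ≥ 1`), core clause at `1−K` (`ω₁ ≤ geomGauge(1−K)`), and the reference flow's start mismatch `E₁` against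
the anchored pulse at the interface shell give `|S₀ᵢ(1−K) − W₀ᵢ(1−K)| ≤ r + δ(n)/ω₁ + E₁`.
[cite: Tao2016AveragedNS, §6.3–6.4 (statement shape); cell LADDER §50 (core clause), §61 (`hsec`, r_s)] -/
theorem interfaceStart_le_of_clauses (P : TubeSchedule) {i₀ : Fin 2} {ustar z S₀ W₀ : Fin 2 → ℤ → ℝ} {n : ℕ}
    {w : ℤ → ℝ} {r ω₁ E₁ : ℝ} (hcore : CoreClause P i₀ ustar n z)
    (hω₁ : 0 < ω₁) (hω₁le : ∀ i, ω₁ ≤ MirrorPulse.geomGauge P.g P.b i (1 - (P.K : ℤ)))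
    (hkick : ∀ i k, w k * |S₀ i k - z i k| ≤ r) (hw1 : ∀ k, 1 ≤ w k)
    (hE₁ : ∀ i, |anchorScale P i₀ z * ustar i (1 - (P.K : ℤ)) - W₀ i (1 - (P.K : ℤ))| ≤ E₁) (i : Fin 2) :
    |S₀ i (1 - (P.K : ℤ)) - W₀ i (1 - (P.K : ℤ))| ≤ r + P.δ n / ω₁ + E₁ := by
  have hkick' : |S₀ i (1 - (P.K : ℤ)) - z i (1 - (P.K : ℤ))| ≤ r := by
    calc |S₀ i (1 - (P.K : ℤ)) - z i (1 - (P.K : ℤ))| = 1 * |S₀ i (1 - (P.K : ℤ)) - z i (1 - (P.K : ℤ))| :=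
        (one_mul _).symm
      _ ≤ w (1 - (P.K : ℤ)) * |S₀ i (1 - (P.K : ℤ)) - z i (1 - (P.K : ℤ))| :=
        mul_le_mul_of_nonneg_right (hw1 _) (abs_nonneg _)
      _ ≤ r := hkick i _
  have hc := hcore i (1 - (P.K : ℤ)) (by omega)
  have hdev : |z i (1 - (P.K : ℤ)) - anchorScale P i₀ z * ustar i (1 - (P.K : ℤ))| ≤ P.δ n / ω₁ := by
    rw [le_div_iff₀ hω₁]
    calc |z i (1 - (P.K : ℤ)) - anchorScale P i₀ z * ustar i (1 - (P.K : ℤ))| * ω₁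
        ≤ |z i (1 - (P.K : ℤ)) - anchorScale P i₀ z * ustar i (1 - (P.K : ℤ))|
            * MirrorPulse.geomGauge P.g P.b i (1 - (P.K : ℤ)) :=
          mul_le_mul_of_nonneg_left (hω₁le i) (abs_nonneg _)
      _ ≤ P.δ n := by rw [mul_comm]; exact hc
  have e : S₀ i (1 - (P.K : ℤ)) - W₀ i (1 - (P.K : ℤ))
      = (S₀ i (1 - (P.K : ℤ)) - z i (1 - (P.K : ℤ)))
        + (z i (1 - (P.K : ℤ)) - anchorScale P i₀ z * ustar i (1 - (P.K : ℤ)))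
        + (anchorScale P i₀ z * ustar i (1 - (P.K : ℤ)) - W₀ i (1 - (P.K : ℤ))) := by ring
  rw [e]
  calc _ ≤ |S₀ i (1 - (P.K : ℤ)) - z i (1 - (P.K : ℤ))
            + (z i (1 - (P.K : ℤ)) - anchorScale P i₀ z * ustar i (1 - (P.K : ℤ)))|
          + |anchorScale P i₀ z * ustar i (1 - (P.K : ℤ)) - W₀ i (1 - (P.K : ℤ))| := abs_add_le _ _
    _ ≤ (|S₀ i (1 - (P.K : ℤ)) - z i (1 - (P.K : ℤ))|
          + |z i (1 - (P.K : ℤ)) - anchorScale P i₀ z * ustar i (1 - (P.K : ℤ))|)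
          + |anchorScale P i₀ z * ustar i (1 - (P.K : ℤ)) - W₀ i (1 - (P.K : ℤ))| := by
        gcongr; exact abs_add_le _ _
    _ ≤ (r + P.δ n / ω₁) + E₁ := add_le_add (add_le_add hkick' hdev) (hE₁ i)

section Step

variable {ε ε₀ : ℝ}

set_option maxHeartbeats 400000 in
/-- **THE INTERFACE LEVELS AT GOOD TIMES** (P-61a, the `hlev` input of the core contract): along every premise of hop `n > N₀` of
the R54 tube and at every good time `t` in the clock window, the interface deviations `|(S−W)₀(1−K, s)| ≤ RBAR`,
`|(S−W)₁(1−K, s)| ≤ BBAR` for all `s ∈ [0, t]`, from the schedule hypotheses (starts from `H(n)`, interface levels L-61a/L-61b,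
near/behind rates and levels in window form) and the deeper core input `ρ₂`.
[cite: Tao2016AveragedNS, §4 (4.1), (4.3), (4.8), §5, §6.3–6.4 (statement shape); route TaoLadderRungTwoFlat, interface loop of record (cell LADDER §61, referee W-27)] -/
theorem interfaceLevels_of_schedule_iface (P : TubeSchedule) {θ' : ℝ} {Wb : ℕ → ℝ} {i₀ : Fin 2}
    {X₀ : Fin 2 → ℝ} {w : ℤ → ℝ} {r c₀ : ℝ} {ζ : ℕ → Fin 2 → ℤ → ℝ} {ustar : Fin 2 → ℤ → ℝ}
    {good : ℕ → (Fin 2 → ℤ → ℝ → ℝ) → ℝ → Prop} {n : ℕ}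
    {cW κ₂ : ℝ} {W₀ FW₀ BW₀ : (Fin 2 → ℤ → ℝ) → Fin 2 → ℤ → ℝ} {W FW : (Fin 2 → ℤ → ℝ) → Fin 2 → ℤ → ℝ → ℝ}
    (hWflow : ∀ z, InTubeWith P (behindR54 P θ' Wb) i₀ X₀ w r ζ ustar n z →
      PseudoFlowOnShift shiftSetFlat cW ε₀ (mirrorTable ε ε) 0 κ₂ (W₀ z) (FW₀ z) (BW₀ z) (W z) (FW z)) (hcW : c₀ ≤ cW)
    (hε : 0 ≤ ε) (hε₀ : 0 < ε₀) (hn : P.N₀ < n) (hK : 1 ≤ P.K) (hDK : P.K + 1 ≤ P.D) (hθV : 0 < P.θV)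
    (hθ : 0 < θ') (hθ5 : θ' ≤ 5 * Real.log (1 + ε₀)) (hw1 : ∀ k, 1 ≤ w k) (hr0 : 0 ≤ r)
    (hAstar : 0 < P.Astar) {ωK MuK : ℝ} (hωK : 0 < ωK)
    (hωKle : ∀ i, ωK ≤ MirrorPulse.geomGauge P.g P.b i (-(P.K : ℤ))) (hMuK : ∀ i, |ustar i (-(P.K : ℤ))| ≤ MuK)
    (hWbn : 0 ≤ Wb n)
    (hwin : ∀ z S₀ τ S F, HopPremiseWith P (behindR54 P θ' Wb) shiftSetFlat ε₀ i₀ (mirrorTable ε ε) X₀ w r c₀ ζ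
      ustar n z S₀ τ S F → ∀ t, good n S t → 0 < t ∧ t ≤ c₀)
    {Aeff A A₀ A₁ M M₁ M₂ rI RBAR BBAR RHO2 rs I₁ I₂ PUMP μN μB VbarN VbarB EW V₀N V₀B EN : ℝ}
    (hAeff : 0 < Aeff) (hM0 : 0 ≤ M)
    (hM : ∀ z, InTubeWith P (behindR54 P θ' Wb) i₀ X₀ w r ζ ustar n z →
      ∀ s ∈ Icc 0 c₀, ∀ i, ∀ m ∈ Finset.Icc (-(P.D : ℤ)) (1 - (P.K : ℤ)), |W z i m s| ≤ M)
    (hM₁ : ∀ z, InTubeWith P (behindR54 P θ' Wb) i₀ X₀ w r ζ ustar n z → ∀ s ∈ Icc 0 c₀, |W z 1 (-(P.K : ℤ)) s| ≤ M₁)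
    (hM₂0 : 0 ≤ M₂)
    (hM₂ : ∀ z, InTubeWith P (behindR54 P θ' Wb) i₀ X₀ w r ζ ustar n z → ∀ s ∈ Icc 0 c₀, |W z 0 (2 - (P.K : ℤ)) s| ≤ M₂)
    (hEW : ∀ z, InTubeWith P (behindR54 P θ' Wb) i₀ X₀ w r ζ ustar n z →
      coMovingEnergyOn (Finset.Icc (1 - (P.D : ℤ)) (-(P.K : ℤ))) P.θV (-(P.K : ℝ))
        (fun i k _ => anchorScale P i₀ z * ustar i k - W₀ z i k) 0 ≤ EW)
    -- section datum at the interface shell and the deeper core input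
    (hsec : ∀ z S₀ τ S F, HopPremiseWith P (behindR54 P θ' Wb) shiftSetFlat ε₀ i₀ (mirrorTable ε ε) X₀ w r c₀ ζ
      ustar n z S₀ τ S F → ∀ i, |(S - W z) i (1 - (P.K : ℤ)) 0| ≤ rs)
    (hρ0 : 0 ≤ RHO2)
    (hcore2 : ∀ z S₀ τ S F, HopPremiseWith P (behindR54 P θ' Wb) shiftSetFlat ε₀ i₀ (mirrorTable ε ε) X₀ w r c₀ ζ
      ustar n z S₀ τ S F → ∀ t, good n S t → ∀ s ∈ Icc 0 t, |(S - W z) 0 (2 - (P.K : ℤ)) s| ≤ RHO2)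
    -- interface levels (L-61a/L-61b) and link facts
    (hRB0 : 0 ≤ RBAR) (hBB0 : 0 ≤ BBAR) (hRr : RBAR ≤ rI) (hBr : BBAR ≤ rI) (hVN0 : 0 ≤ VbarN)
    (hI₁0 : 0 ≤ I₁) (hI₂0 : 0 ≤ I₂)
    (hI₁ : 2 * (Real.exp (P.θV / 2) - 1) ≤ I₁ * P.θV) (hI₂ : Real.exp P.θV - 1 ≤ I₂ * P.θV)
    (hPUMPdef : PUMP = 1 * c₀ * ((2 + ε) * M * I₁ * Real.sqrt (2 * VbarN) + 2 * I₂ * VbarN))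
    (hlevC : rs + PUMP + 1 * c₀ * ((ε * (M + I₁ * Real.sqrt (2 * VbarN)) + ε * M + ε * BBAR) * RBAR
      + (2 + ε) * M * BBAR + BBAR ^ 2) < RBAR)
    (hlevV : rs + 1 * c₀ * ((M + M₂ + RBAR + RHO2) * BBAR + (1 + 2 * ε) * M * RBAR + ε * RBAR ^ 2
      + (M + 2 * ε * M₂) * RHO2 + ε * RHO2 ^ 2) < BBAR)
    -- near/behind schedule (window forms)
    (hAdef : A = Real.sqrt (2 * VbarB) * Real.exp (θ' / 2) * Real.exp (θ' * ((P.D : ℝ) - P.K) / 2) + M)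
    (hA₀def : A₀ = M + rI) (hA₁def : A₁ = M₁ + Real.sqrt (2 * VbarN) * Real.exp (P.θV / 2))
    (hrA : rI ≤ A) (hA₀le : A₀ ≤ Aeff)
    (hV₀Ndef : V₀N = (Real.sqrt (P.v n + (P.δ n / ωK) ^ 2) + Real.sqrt P.D * r + Real.sqrt EW) ^ 2)
    (hV₀Bdef : V₀B = (Real.sqrt (Wb n + (MuK + P.δ n / ωK) ^ 2) + r / Real.sqrt (1 - Real.exp (-θ'))) ^ 2)
    (hENdef : EN = Real.exp (P.θV * ((1 : ℝ) - P.D + P.K)) * ((1 + ε) * 1 * A ^ 2 * (A + M))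
      + 1 * rI * (2 * VbarN + ε * rI * Real.sqrt (2 * VbarN) + (1 + ε) * M * rI))
    (hμN : 0 < μN)
    (hμNle : μN ≤ (1 / c₀) * P.θV - 2 * (1 + ε) * 1 * (A * Real.sinh (P.θV / 2) + M * (3 + Real.exp P.θV)))
    (hμB : 0 < μB) (hμBle : μB ≤ (1 / c₀) * θ' - 2 * (1 + ε) * Aeff * Real.sinh (θ' / 2))
    (hlevN : V₀N + EN * c₀ < VbarN) (hlevB : V₀B + A₁ * A₀ * (A₁ + ε * A₀) * c₀ < VbarB)
    (hclose : Real.sqrt (2 * VbarB) * Real.exp (θ' / 2) ≤ Aeff) :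
    ∀ z S₀ τ S F, HopPremiseWith P (behindR54 P θ' Wb) shiftSetFlat ε₀ i₀ (mirrorTable ε ε) X₀ w r c₀ ζ
      ustar n z S₀ τ S F → ∀ t, good n S t →
        ∀ s ∈ Icc 0 t, |(S - W z) 0 (1 - (P.K : ℤ)) s| ≤ RBAR ∧ |(S - W z) 1 (1 - (P.K : ℤ)) s| ≤ BBAR := by
  intro z S₀ τf S F hprem t hgood
  obtain ⟨htpos, htc₀⟩ := hwin z S₀ τf S F hprem t hgood
  have hsec_t := hsec z S₀ τf S F hprem
  have hcore_t := hcore2 z S₀ τf S F hprem t hgood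
  obtain ⟨hz, hkick, hc₀τ, hflow⟩ := hprem
  -- the clauses of `H(n)` (tube phase)
  have hzW : InTubeWith P (behindR54 P θ' Wb) i₀ X₀ w r ζ ustar n z := hz
  have h0 : n ≠ 0 := by omega
  have h1 : ¬ n ≤ P.N₀ := by omega
  simp only [InTubeWith, h0, if_false, h1] at hz
  obtain ⟨hanch, hcoreCl, hnearCl, hbeh, -⟩ := hz
  -- the reference flow of this premise (co-scaled family, TRAP #25 cure (α))
  have hWz := hWflow z hzW
  -- restrict both flows to `[0, t]`
  have hS' := pseudoFlowOnShift_mono hflow htpos (htc₀.trans hc₀τ)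
  have hW' := pseudoFlowOnShift_mono hWz htpos (htc₀.trans hcW)
  -- the kick, everywhere (weights `≥ 1`)
  have hkick' : ∀ i k, |S₀ i k - z i k| ≤ r := by
    intro i k
    calc |S₀ i k - z i k| = 1 * |S₀ i k - z i k| := (one_mul _).symm
      _ ≤ w k * |S₀ i k - z i k| := mul_le_mul_of_nonneg_right (hw1 k) (abs_nonneg _)
      _ ≤ r := hkick i k
  -- the STARTS from `H(n)`
  have hstartN : coMovingEnergyOn (Finset.Icc (1 - (P.D : ℤ)) (-(P.K : ℤ))) P.θV (-(P.K : ℝ)) (S - W z) 0 ≤ V₀N := by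
    have h := sqrt_initial_coMovingEnergyOn_le_additive P hflow.init_S hWz.init_S hθV.le hDK hnearCl hcoreCl hωK hωKle
      (fun i k _ => hkick' i k) hr0 (hEW z hzW)
    have hnn : 0 ≤ coMovingEnergyOn (Finset.Icc (1 - (P.D : ℤ)) (-(P.K : ℤ))) P.θV (-(P.K : ℝ)) (S - W z) 0 :=
      coMovingEnergyOn_nonneg _ _ _ _ _
    rw [hV₀Ndef]
    calc coMovingEnergyOn (Finset.Icc (1 - (P.D : ℤ)) (-(P.K : ℤ))) P.θV (-(P.K : ℝ)) (S - W z) 0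
        = Real.sqrt (coMovingEnergyOn (Finset.Icc (1 - (P.D : ℤ)) (-(P.K : ℤ))) P.θV (-(P.K : ℝ)) (S - W z) 0) ^ 2 :=
          (Real.sq_sqrt hnn).symm
      _ ≤ _ := pow_le_pow_left₀ (Real.sqrt_nonneg _) h 2
  have haK : ∀ i, |z i (-(P.K : ℤ))| ≤ MuK + P.δ n / ωK := fun i =>
    abs_windowBottom_le_of_clauses P hAstar hanch hcoreCl hωK hωKle hMuK i
  have hstartB : ∀ L : ℕ, coMovingEnergyOn (Finset.Icc (1 - (P.K : ℤ) - L) (-(P.K : ℤ))) θ' (-(P.K : ℝ)) S 0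
      ≤ V₀B := by
    intro L
    rw [hV₀Bdef]
    exact R54.initial_blockEnergy_le_additive hflow.init_S hθ hbeh.1 hWbn haK (fun i k hk => hkick' i k) hr0
  -- the interface loop on `[0, t]`
  rw [hENdef] at hlevN
  exact R54.interface_apriori_of_pseudoFlows hW' hS' hε hε₀ hK hDK hθV hθ.le hθ5 hAeff htpos le_rfl htc₀ hM0
    (fun s hs => hM z hzW s ⟨hs.1, hs.2.trans htc₀⟩) (fun s hs => hM₁ z hzW s ⟨hs.1, hs.2.trans htc₀⟩) hM₂0
    (fun s hs => hM₂ z hzW s ⟨hs.1, hs.2.trans htc₀⟩) hsec_t hρ0 hcore_t hRB0 hBB0 hRr hBr hVN0 hI₁0 hI₂0 hI₁ hI₂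
    hPUMPdef hlevC hlevV hAdef hA₀def hA₁def hrA hA₀le hstartN hstartB hμN hμNle hμB hμBle hlevN hlevB hclose

set_option maxHeartbeats 400000 in
/-- **`TubeStepNear` ∧ `TubeStepBehind` OF THE R54 TUBE AT THE CHOICE RULE WITH THE INTERFACE LOOP OF RECORD** (theory-1
g48 P-61a): `…_halo` with the in-hop core input `hcoreIn` replaced by the section datum `hsec`, the deeper core input `hcore2`
(`ρ₂` at shell `2−K`) and the two certified interface levels `hlevC`/`hlevV`. See the module docstring for the literal shapes.
[cite: Tao2016AveragedNS, §4 (4.1), (4.3), (4.5), (4.8), §6.3–6.4 Props. 6.4–6.5 (statement shape of the inductive step); route TaoLadderRungTwoFlat, `HopTube.TubeStepNearWith`/`TubeStepBehindWith` for `behindR54` with the interface loop (cell LADDER §50, §54–§61, referee W-27)] -/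
theorem tubeStepNearBehindR54_of_schedule_iface (P : TubeSchedule) {θ' : ℝ} {Wb : ℕ → ℝ} {i₀ : Fin 2}
    {X₀ : Fin 2 → ℝ} {w : ℤ → ℝ} {r θ₀ c₀ t₀ : ℝ} {ζ : ℕ → Fin 2 → ℤ → ℝ} {ustar : Fin 2 → ℤ → ℝ}
    {good : ℕ → (Fin 2 → ℤ → ℝ → ℝ) → ℝ → Prop} {n : ℕ}
    {cW κ₂ : ℝ} {W₀ FW₀ BW₀ : (Fin 2 → ℤ → ℝ) → Fin 2 → ℤ → ℝ} {W FW : (Fin 2 → ℤ → ℝ) → Fin 2 → ℤ → ℝ → ℝ}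
    (hWflow : ∀ z, InTubeWith P (behindR54 P θ' Wb) i₀ X₀ w r ζ ustar n z →
      PseudoFlowOnShift shiftSetFlat cW ε₀ (mirrorTable ε ε) 0 κ₂ (W₀ z) (FW₀ z) (BW₀ z) (W z) (FW z)) (hcW : c₀ ≤ cW)
    (hε : 0 ≤ ε) (hε₀ : 0 < ε₀) (hn : P.N₀ < n) (hK : 1 ≤ P.K) (hDK : P.K + 1 ≤ P.D) (hθV : 0 < P.θV)
    (hθ : 0 < θ') (hθ5 : θ' ≤ 5 * Real.log (1 + ε₀)) (hw1 : ∀ k, 1 ≤ w k) (hr0 : 0 ≤ r)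
    (hAstar : 0 < P.Astar) {ωK MuK : ℝ} (hωK : 0 < ωK)
    (hωKle : ∀ i, ωK ≤ MirrorPulse.geomGauge P.g P.b i (-(P.K : ℤ))) (hMuK : ∀ i, |ustar i (-(P.K : ℤ))| ≤ MuK)
    (hWbn : 0 ≤ Wb n) (hWbn1 : 0 ≤ Wb (n + 1)) (hvn1 : 0 ≤ P.v (n + 1))
    {tlo : ℝ} (htlo : 0 < tlo)
    (hex : ∀ z S₀ τ S F, HopPremiseWith P (behindR54 P θ' Wb) shiftSetFlat ε₀ i₀ (mirrorTable ε ε) X₀ w r c₀ ζ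
      ustar n z S₀ τ S F → ∃ t, good n S t)
    (hwin : ∀ z S₀ τ S F, HopPremiseWith P (behindR54 P θ' Wb) shiftSetFlat ε₀ i₀ (mirrorTable ε ε) X₀ w r c₀ ζ
      ustar n z S₀ τ S F → ∀ t, good n S t → tlo ≤ t ∧ t ≤ c₀)
    {alo : ℝ} (halo0 : 0 ≤ alo)
    (halo : ∀ z S₀ τ S F, HopPremiseWith P (behindR54 P θ' Wb) shiftSetFlat ε₀ i₀ (mirrorTable ε ε) X₀ w r c₀ ζ
      ustar n z S₀ τ S F → ∀ t, good n S t → alo ≤ clampedRatio P i₀ ε₀ θ₀ t S)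
    {Aeff A A₀ A₁ M M₁ M₂ rI RBAR BBAR RHO2 rs I₁ I₂ PUMP μN μB VbarN VbarB EW RT V₀N V₀B EN : ℝ}
    (hAeff : 0 < Aeff) (hM0 : 0 ≤ M)
    (hM : ∀ z, InTubeWith P (behindR54 P θ' Wb) i₀ X₀ w r ζ ustar n z →
      ∀ s ∈ Icc 0 c₀, ∀ i, ∀ m ∈ Finset.Icc (-(P.D : ℤ)) (1 - (P.K : ℤ)), |W z i m s| ≤ M)
    (hM₁ : ∀ z, InTubeWith P (behindR54 P θ' Wb) i₀ X₀ w r ζ ustar n z → ∀ s ∈ Icc 0 c₀, |W z 1 (-(P.K : ℤ)) s| ≤ M₁)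
    (hM₂0 : 0 ≤ M₂)
    (hM₂ : ∀ z, InTubeWith P (behindR54 P θ' Wb) i₀ X₀ w r ζ ustar n z → ∀ s ∈ Icc 0 c₀, |W z 0 (2 - (P.K : ℤ)) s| ≤ M₂)
    (hEW : ∀ z, InTubeWith P (behindR54 P θ' Wb) i₀ X₀ w r ζ ustar n z →
      coMovingEnergyOn (Finset.Icc (1 - (P.D : ℤ)) (-(P.K : ℤ))) P.θV (-(P.K : ℝ))
        (fun i k _ => anchorScale P i₀ z * ustar i k - W₀ z i k) 0 ≤ EW)
    -- section datum at the interface shell and the deeper core input (the only in-hop core data)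
    (hsec : ∀ z S₀ τ S F, HopPremiseWith P (behindR54 P θ' Wb) shiftSetFlat ε₀ i₀ (mirrorTable ε ε) X₀ w r c₀ ζ
      ustar n z S₀ τ S F → ∀ i, |(S - W z) i (1 - (P.K : ℤ)) 0| ≤ rs)
    (hρ0 : 0 ≤ RHO2)
    (hcore2 : ∀ z S₀ τ S F, HopPremiseWith P (behindR54 P θ' Wb) shiftSetFlat ε₀ i₀ (mirrorTable ε ε) X₀ w r c₀ ζ
      ustar n z S₀ τ S F → ∀ t, good n S t → ∀ s ∈ Icc 0 t, |(S - W z) 0 (2 - (P.K : ℤ)) s| ≤ RHO2)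
    -- interface levels (L-61a/L-61b) and link facts
    (hRB0 : 0 ≤ RBAR) (hBB0 : 0 ≤ BBAR) (hRr : RBAR ≤ rI) (hBr : BBAR ≤ rI) (hVN0 : 0 ≤ VbarN)
    (hI₁0 : 0 ≤ I₁) (hI₂0 : 0 ≤ I₂)
    (hI₁ : 2 * (Real.exp (P.θV / 2) - 1) ≤ I₁ * P.θV) (hI₂ : Real.exp P.θV - 1 ≤ I₂ * P.θV)
    (hPUMPdef : PUMP = 1 * c₀ * ((2 + ε) * M * I₁ * Real.sqrt (2 * VbarN) + 2 * I₂ * VbarN))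
    (hlevC : rs + PUMP + 1 * c₀ * ((ε * (M + I₁ * Real.sqrt (2 * VbarN)) + ε * M + ε * BBAR) * RBAR
      + (2 + ε) * M * BBAR + BBAR ^ 2) < RBAR)
    (hlevV : rs + 1 * c₀ * ((M + M₂ + RBAR + RHO2) * BBAR + (1 + 2 * ε) * M * RBAR + ε * RBAR ^ 2
      + (M + 2 * ε * M₂) * RHO2 + ε * RHO2 ^ 2) < BBAR)
    -- the template landing residual (reference data)
    (hRT : ∀ z S₀ τ S F, HopPremiseWith P (behindR54 P θ' Wb) shiftSetFlat ε₀ i₀ (mirrorTable ε ε) X₀ w r c₀ ζ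
      ustar n z S₀ τ S F → ∀ t, good n S t →
        ∑ k ∈ Finset.Icc (-(P.D : ℤ)) (-(P.K : ℤ) - 1), Real.exp (P.θV * ((k : ℝ) + P.K)) *
          ∑ i : Fin 2, (W z i (1 + k) t - |S i₀ 1 t| / P.Astar * ustar i k) ^ 2 / 2 ≤ RT)
    -- near/behind schedule (window forms)
    (hAdef : A = Real.sqrt (2 * VbarB) * Real.exp (θ' / 2) * Real.exp (θ' * ((P.D : ℝ) - P.K) / 2) + M)
    (hA₀def : A₀ = M + rI) (hA₁def : A₁ = M₁ + Real.sqrt (2 * VbarN) * Real.exp (P.θV / 2))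
    (hrA : rI ≤ A) (hA₀le : A₀ ≤ Aeff)
    (hV₀Ndef : V₀N = (Real.sqrt (P.v n + (P.δ n / ωK) ^ 2) + Real.sqrt P.D * r + Real.sqrt EW) ^ 2)
    (hV₀Bdef : V₀B = (Real.sqrt (Wb n + (MuK + P.δ n / ωK) ^ 2) + r / Real.sqrt (1 - Real.exp (-θ'))) ^ 2)
    (hENdef : EN = Real.exp (P.θV * ((1 : ℝ) - P.D + P.K)) * ((1 + ε) * 1 * A ^ 2 * (A + M))
      + 1 * rI * (2 * VbarN + ε * rI * Real.sqrt (2 * VbarN) + (1 + ε) * M * rI))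
    (hμN : 0 < μN)
    (hμNle : μN ≤ (1 / c₀) * P.θV - 2 * (1 + ε) * 1 * (A * Real.sinh (P.θV / 2) + M * (3 + Real.exp P.θV)))
    (hμB : 0 < μB) (hμBle : μB ≤ (1 / c₀) * θ' - 2 * (1 + ε) * Aeff * Real.sinh (θ' / 2))
    (hlevN : V₀N + EN * c₀ < VbarN) (hlevB : V₀B + A₁ * A₀ * (A₁ + ε * A₀) * c₀ < VbarB)
    (hclose : Real.sqrt (2 * VbarB) * Real.exp (θ' / 2) ≤ Aeff)
    (hbudgetN : ∀ t ∈ Icc tlo c₀, (Real.sqrt (Real.exp (-μN * t) * V₀N + EN * (1 - Real.exp (-μN * t)) / μN)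
      + Real.sqrt RT) ^ 2 ≤ alo ^ 2 * P.v (n + 1))
    (hbudgetB : ∀ t ∈ Icc tlo c₀, Real.exp (-μB * t) * V₀B + A₁ * A₀ * (A₁ + ε * A₀) * (1 - Real.exp (-μB * t)) / μB
      ≤ alo ^ 2 * Wb (n + 1)) :
    TubeStepNearWith P (behindR54 P θ' Wb) (choiceRule P i₀ ε₀ θ₀ t₀ good) shiftSetFlat ε₀ i₀ (mirrorTable ε ε)
        X₀ w r c₀ ζ ustar n ∧
      TubeStepBehindWith P (behindR54 P θ' Wb) (choiceRule P i₀ ε₀ θ₀ t₀ good) shiftSetFlat ε₀ i₀ (mirrorTable ε ε)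
        X₀ w r c₀ ζ ustar n := by
  have hε₀' : (-1 : ℝ) < ε₀ := by linarith
  have hrI0 : 0 ≤ rI := hRB0.trans hRr
  have hA0 : 0 ≤ A := hrI0.trans hrA
  have hEN0 : 0 ≤ EN := by rw [hENdef]; positivity
  have hwin' : ∀ z S₀ τ S F, HopPremiseWith P (behindR54 P θ' Wb) shiftSetFlat ε₀ i₀ (mirrorTable ε ε) X₀ w r c₀ ζ
      ustar n z S₀ τ S F → ∀ t, good n S t → 0 < t ∧ t ≤ c₀ := fun z S₀ τ S F h t ht =>
    ⟨htlo.trans_le (hwin z S₀ τ S F h t ht).1, (hwin z S₀ τ S F h t ht).2⟩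
  -- the interface levels at good times (the loop of record)
  have hlev := interfaceLevels_of_schedule_iface P hWflow hcW hε hε₀ hn hK hDK hθV hθ hθ5 hw1 hr0 hAstar hωK hωKle
    hMuK hWbn hwin' hAeff hM0 hM hM₁ hM₂0 hM₂ hEW hsec hρ0 hcore2 hRB0 hBB0 hRr hBr hVN0 hI₁0 hI₂0 hI₁ hI₂ hPUMPdef
    hlevC hlevV hAdef hA₀def hA₁def hrA hA₀le hV₀Ndef hV₀Bdef hENdef hμN hμNle hμB hμBle hlevN hlevB hclose
  -- the two landing clauses at every good time of every premise
  have key : ∀ z S₀ τ S F, HopPremiseWith P (behindR54 P θ' Wb) shiftSetFlat ε₀ i₀ (mirrorTable ε ε) X₀ w r c₀ ζ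
      ustar n z S₀ τ S F → ∀ t, good n S t →
        NearClause P i₀ ustar (n + 1) (recentre S t (clampedRatio P i₀ ε₀ θ₀ t S)) ∧
        R54.BehindEnergyClause P.K θ' (Wb (n + 1)) (recentre S t (clampedRatio P i₀ ε₀ θ₀ t S)) := by
    intro z S₀ τf S F hprem t hgood
    obtain ⟨htlo_t, htc₀⟩ := hwin z S₀ τf S F hprem t hgood
    have htpos : 0 < t := htlo.trans_le htlo_t
    -- the interface level `rI` on `[0, t]` (both species)
    have hcore_t : ∀ s ∈ Icc 0 t, ∀ i, |(S - W z) i (1 - (P.K : ℤ)) s| ≤ rI := by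
      intro s hs i
      obtain ⟨h0, h1⟩ := hlev z S₀ τf S F hprem t hgood s hs
      fin_cases i
      · exact h0.trans hRr
      · exact h1.trans hBr
    have hRT_t := hRT z S₀ τf S F hprem t hgood
    have halo_t := halo z S₀ τf S F hprem t hgood
    obtain ⟨hz, hkick, hc₀τ, hflow⟩ := hprem
    -- the clauses of `H(n)` (tube phase)
    have hzW : InTubeWith P (behindR54 P θ' Wb) i₀ X₀ w r ζ ustar n z := hz
    have h0 : n ≠ 0 := by omega
    have h1 : ¬ n ≤ P.N₀ := by omega
    simp only [InTubeWith, h0, if_false, h1] at hz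
    obtain ⟨hanch, hcoreCl, hnearCl, hbeh, -⟩ := hz
    have hWz := hWflow z hzW
    -- restrict both flows to `[0, t]`
    have hS' := pseudoFlowOnShift_mono hflow htpos (htc₀.trans hc₀τ)
    have hW' := pseudoFlowOnShift_mono hWz htpos (htc₀.trans hcW)
    -- the kick, everywhere (weights `≥ 1`)
    have hkick' : ∀ i k, |S₀ i k - z i k| ≤ r := by
      intro i k
      calc |S₀ i k - z i k| = 1 * |S₀ i k - z i k| := (one_mul _).symm
        _ ≤ w k * |S₀ i k - z i k| := mul_le_mul_of_nonneg_right (hw1 k) (abs_nonneg _)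
        _ ≤ r := hkick i k
    -- the ratio of the choice rule
    have ha : 0 < clampedRatio P i₀ ε₀ θ₀ t S := clampedRatio_pos P i₀ hε₀' θ₀ t S
    have hfa2 : alo ^ 2 ≤ clampedRatio P i₀ ε₀ θ₀ t S ^ 2 := pow_le_pow_left₀ halo0 halo_t 2
    -- the STARTS from `H(n)`
    have hstartN : coMovingEnergyOn (Finset.Icc (1 - (P.D : ℤ)) (-(P.K : ℤ))) P.θV (-(P.K : ℝ)) (S - W z) 0 ≤ V₀N := by
      have h := sqrt_initial_coMovingEnergyOn_le_additive P hflow.init_S hWz.init_S hθV.le hDK hnearCl hcoreCl hωK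
        hωKle (fun i k _ => hkick' i k) hr0 (hEW z hzW)
      have hnn : 0 ≤ coMovingEnergyOn (Finset.Icc (1 - (P.D : ℤ)) (-(P.K : ℤ))) P.θV (-(P.K : ℝ)) (S - W z) 0 :=
        coMovingEnergyOn_nonneg _ _ _ _ _
      rw [hV₀Ndef]
      calc coMovingEnergyOn (Finset.Icc (1 - (P.D : ℤ)) (-(P.K : ℤ))) P.θV (-(P.K : ℝ)) (S - W z) 0
          = Real.sqrt (coMovingEnergyOn (Finset.Icc (1 - (P.D : ℤ)) (-(P.K : ℤ))) P.θV (-(P.K : ℝ)) (S - W z) 0) ^ 2 :=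
            (Real.sq_sqrt hnn).symm
        _ ≤ _ := pow_le_pow_left₀ (Real.sqrt_nonneg _) h 2
    have haK : ∀ i, |z i (-(P.K : ℤ))| ≤ MuK + P.δ n / ωK := fun i =>
      abs_windowBottom_le_of_clauses P hAstar hanch hcoreCl hωK hωKle hMuK i
    have hstartB : ∀ L : ℕ, coMovingEnergyOn (Finset.Icc (1 - (P.K : ℤ) - L) (-(P.K : ℤ))) θ' (-(P.K : ℝ)) S 0
        ≤ V₀B := by
      intro L
      rw [hV₀Bdef]
      exact R54.initial_blockEnergy_le_additive hflow.init_S hθ hbeh.1 hWbn haK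
        (fun i k hk => hkick' i k) hr0
    -- rates and levels at this `t ≤ c₀`
    have h1t : 1 / c₀ ≤ 1 / t := one_div_le_one_div_of_le htpos htc₀
    have hμNle' : μN ≤ (1 / t) * P.θV - 2 * (1 + ε) * 1 * (A * Real.sinh (P.θV / 2) + M * (3 + Real.exp P.θV)) := by
      have h2 := mul_le_mul_of_nonneg_right h1t hθV.le
      linarith only [h2, hμNle]
    have hμBle' : μB ≤ (1 / t) * θ' - 2 * (1 + ε) * Aeff * Real.sinh (θ' / 2) := by
      have h2 := mul_le_mul_of_nonneg_right h1t hθ.le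
      linarith only [h2, hμBle]
    have hlevN' : V₀N + EN * t < VbarN := by
      have h2 := mul_le_mul_of_nonneg_left htc₀ hEN0
      linarith only [h2, hlevN]
    have hA₁0 : 0 ≤ A₁ := by
      rw [hA₁def]
      have hM₁0 : 0 ≤ M₁ := (abs_nonneg _).trans (hM₁ z hzW 0 ⟨le_rfl, htpos.le.trans htc₀⟩)
      exact add_nonneg hM₁0 (mul_nonneg (Real.sqrt_nonneg _) (Real.exp_pos _).le)
    have hA₀0 : 0 ≤ A₀ := by rw [hA₀def]; exact add_nonneg hM0 hrI0
    have hEtop0 : 0 ≤ A₁ * A₀ * (A₁ + ε * A₀) :=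
      mul_nonneg (mul_nonneg hA₁0 hA₀0) (add_nonneg hA₁0 (mul_nonneg hε hA₀0))
    have hlevB' : V₀B + A₁ * A₀ * (A₁ + ε * A₀) * t < VbarB := by
      have h2 := mul_le_mul_of_nonneg_left htc₀ hEtop0
      linarith only [h2, hlevB]
    have hστ : (1 / t) * t = 1 := by rw [one_div, inv_mul_cancel₀ (ne_of_gt htpos)]
    -- budgets at the clamped ratio
    have hbN := hbudgetN t ⟨htlo_t, htc₀⟩
    have hbB := hbudgetB t ⟨htlo_t, htc₀⟩
    have hbN' : (Real.sqrt (Real.exp (-μN * t) * V₀N + EN * (1 - Real.exp (-μN * t)) / μN) + Real.sqrt RT) ^ 2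
        ≤ clampedRatio P i₀ ε₀ θ₀ t S ^ 2 * P.v (n + 1) :=
      hbN.trans (mul_le_mul_of_nonneg_right hfa2 hvn1)
    have hbB' : Real.exp (-μB * t) * V₀B + A₁ * A₀ * (A₁ + ε * A₀) * (1 - Real.exp (-μB * t)) / μB
        ≤ clampedRatio P i₀ ε₀ θ₀ t S ^ 2 * Wb (n + 1) :=
      hbB.trans (mul_le_mul_of_nonneg_right hfa2 hWbn1)
    -- the joint hop with the level-fed top input
    rw [hENdef] at hbN' hlevN'
    exact R54.near_behind_hop_of_schedule_iface P hW' hS' hε hε₀ hDK hθV.le hθ.le hθ5 hAeff htpos le_rfl hστ ha hM0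
      (fun s hs => hM z hzW s ⟨hs.1, hs.2.trans htc₀⟩) (fun s hs => hM₁ z hzW s ⟨hs.1, hs.2.trans htc₀⟩) hcore_t hrI0 hVN0
      hAdef hA₀def hA₁def hrA hA₀le hstartN hstartB hμN hμNle' hμB hμBle' hlevN' hlevB' hclose hRT_t hbN' hbB'
  exact ⟨tubeStepNearWith_of_good hex fun z S₀ τ S F h t ht => (key z S₀ τ S F h t ht).1,
    tubeStepBehindR54_of_good hε₀' hex hwin' fun z S₀ τ S F h t ht => (key z S₀ τ S F h t ht).2⟩

end Step

end Summit.NavierStokesRegularity.NavierStokesRegularity.Theorems.HopTube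

end
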